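import Summits.ResolutionOfSingularities.ResolutionOfSingularities.Theorems.FrobeniusLadderFInjectiveMacaulayficationRetractClause
import Mathlib.RingTheory.LocalRing.MaximalIdeal.Basic
import Mathlib.RingTheory.KrullDimension.Basic
import HarnessLib

/-!
# LEMMA L′ — the CM clause and the F-clause descend along a split ring map from local data over the closed point
(crux `FInjectiveMacaulayfication`, stmt-ResolutionOfSingularities-15315; line `H4LocRepair`, door v30 `stub_closedCentreExists`;
the local-cohomology-free KERNEL of PROP SQH⁺ / THEOREM Q of the dim ≥ 4 census `ROUTES-DIM4.md` §1-ter/§1-quater)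

Support file (helper, proves no registered stub by name).  Statement (res-L1-w45a-tri-2, FIRST-STEP lens, 2026-08-27; adopted by the
statement owner res-L1-w45a-strat-1 as `H4LocRepairSig` §10⁵): let `(C, 𝔪_C)` be a local ring and `C → A'` an algebra with a
`C`-linear retraction `ρ : A' → C`, `ρ ∘ algebraMap = id` (so `I·A' ∩ C = I` for every ideal `I` of `C`).  Suppose
* (H1′) for every maximal ideal `N` of `A'` and every system of parameters `s` of `C` (typed as in the crux: `d = dim C` elements whose
  span has maximal radical) the image of `s` is a weakly regular sequence on the localisation `A'_N`;
* (H2) for every maximal ideal `N ⊇ 𝔪_C A'` and every such `s`, the extended ideal `(s)A'_N` is Frobenius closed (inline form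
  `z ^ q ∈ ((s)A'_N)^[q] → z ∈ (s)A'_N`, `q = p ^ e`).
Then every system of parameters of `C` is weakly regular on `C` (the CM clause `CMCl C`) and generates a Frobenius closed ideal (the
F-clause `FCl p C`) — the two clauses of the crux's stalk condition, stated here EXPANDED (they are the bodies of the tree's reducible
abbreviations `…Theorems.FInjectiveMacaulayfication.SliceableCentre.CMCl/FCl`, so the theorem closes those by `exact`).  Both hypotheses
are quantified over an ARBITRARY presentation `(L) [IsLocalization.AtPrime L N]` of the localisation (the geometric layer discharging
them on blow-up charts never meets a `Localization`/`Subalgebra` instance diamond); the proof instantiates `L := Localization.AtPrime N`.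

Proof (ten lines on paper; here a corollary of the tree's retract-descent package, cycle 4):
* CM: `RetractClause.isWeaklyRegular_of_retract_of_localization` — weak regularity of the image list on `A'` is tested at the maximal
  ideals (`isWeaklyRegular_of_localization_maximal`), and descends along the retraction (`retract_mem`, `retract_algebraMap`).
* F: if `y ^ q ∈ (s)^[q] C` then `(algebraMap y) ^ q ∈ ((s)A')^[q]` (`FRationalResolution.weaklyFRegularClause_of_retract_map_mem`);
  membership `algebraMap y ∈ (s)A'` is tested at the maximal ideals `N` of `A'` (`Ideal.mem_of_localization_maximal`), trivially at those
  NOT containing `(s)A'` (there `(s)A'_N = ⊤`: `mem_of_frobenius_localization_maximal_le`), and at those containing `(s)A'` we have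
  `N ∩ C ⊇ √(s) = 𝔪_C` (`Ideal.IsPrime.radical_le_iff`, `IsLocalRing.eq_maximalIdeal`), so (H2) applies; finally
  `y = ρ (algebraMap y) ∈ (s)A' ∩ C = (s)C` (`retract_mem`).
The only difference from `RetractClause.stub_clauseOfRetract` (which assumes BOTH local conditions at EVERY maximal ideal of the top
ring) is the SUPPORT LOCALISATION of the Frobenius hypothesis to the maximal ideals over `𝔪_C` — exactly what PROP SQH⁺ supplies on the
`𝔾_m`-cover charts `A' = G[X_i⁻¹][s]`-type rings, where (H2) comes from «CM + F-injective deforms» at the points over the closed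
fibre and (H1′) from the fibre-height count (the degree-`w` unit).  No Noetherian, characteristic, injectivity or domain hypothesis is
used (the `IsNoetherianRing C` binder of the §10⁵ signature is dropped here).  No named facts.

NEAREST TREE LEMMAS (dedup check of RULING R15.5 (2), res-L1-w45a-plan-1, after res-L1-w45a-tri-2's prior-art audit): E4 = cycle-4
`DegreeZeroDescent.clause_of_retract` / `RetractClause.stub_clauseOfRetract` (p133979-era degree-zero descent of the clause along a
retraction).  DELTA, which is why this is a verbatim filing and not an alias: (a) `stub_clauseOfRetract` asks (H1)+(H2) at EVERY maximal
ideal of `A'`; `clause_of_retract` does localise the support to the maximal `P ⊇ (s)A'` (= `P ⊇ 𝔪_C A'` when `√(s) = 𝔪_C`) but asks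
there for the FULL clause of `A'_P` (all its systems of parameters) plus the dimension data `dim A'_P = d + e`, `dim A'_P/(s) = e`, and
derives the images clause through `ExtendSop`/`PartialSop`; L′ asks at `N ⊇ 𝔪_C A'` only the Frobenius-closedness of the one extended
ideal `(s)A'_N` (H2) — the currency PROP SQH⁺ produces — and (H1′) in images form; (b) both E4 forms carry `[Fact p.Prime] [CharP A p]`
(through `IsFrobeniusClosed`), L′ has neither (any `p : ℕ`, any local `C`), so the `H4LocRepairSig` §10⁵ signature is NOT an instance
of E4; (c) the ∀-presentation idiom.  The proof below is nevertheless pure glue over E4's package (`RetractClause.*`,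
`FRationalResolution.weaklyFRegularClause_of_retract_map_mem`). [res-L1-w45a-stub-4 g6, filer]

## References
* [HochsterHuneke1990] M. Hochster, C. Huneke, *Tight closure, invariant theory, and the Briançon–Skoda theorem*, J. Amer. Math.
  Soc. 3 (1990), Prop. 4.12 (direct summands).
* [BrunsHerzog1998] W. Bruns, J. Herzog, *Cohen–Macaulay rings*, Cambridge Stud. Adv. Math. 39 (rev. ed. 1998), §1.1, §2.1
  (regular sequences; local criteria).
-/

-- single-problem summit: the doubled namespace component is forced
set_option linter.dupNamespace false

namespace Summit.ResolutionOfSingularities.ResolutionOfSingularities.Theorems.FInjectiveMacaulayfication.LemmaLPrime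

open IsLocalRing RingTheory.Sequence
open Summit.ResolutionOfSingularities.ResolutionOfSingularities.Theorems.FInjectiveMacaulayfication.RetractClause
open Summit.ResolutionOfSingularities.ResolutionOfSingularities.Theorems.FRationalResolution

/-- Membership in an ideal `J` is tested, in inline Frobenius-closure form, at the maximal ideals CONTAINING `J` only: at a maximal
`P ⊉ J` the extension `J B_P` is the unit ideal. (Support-localised form of `RetractClause.mem_of_frobenius_localization_maximal`.)
[folklore] -/
theorem mem_of_frobenius_localization_maximal_le (p : ℕ) {B : Type} [CommRing B] (J : Ideal B)
    (h : ∀ (P : Ideal B) (_ : P.IsMaximal), J ≤ P → ∀ (y : Localization.AtPrime P),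
      (∃ e : ℕ, y ^ p ^ e ∈ Ideal.span ((fun z : Localization.AtPrime P => z ^ p ^ e) ''
        (J.map (algebraMap B (Localization.AtPrime P)) : Set (Localization.AtPrime P)))) →
      y ∈ J.map (algebraMap B (Localization.AtPrime P)))
    {y : B} (hy : ∃ e : ℕ, y ^ p ^ e ∈ Ideal.span ((fun z : B => z ^ p ^ e) '' (J : Set B))) :
    y ∈ J := by
  obtain ⟨e, he⟩ := hy
  refine Ideal.mem_of_localization_maximal fun P hP => ?_
  by_cases hJP : J ≤ P
  · refine h P hP hJP _ ⟨e, ?_⟩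
    rw [← map_pow]
    exact weaklyFRegularClause_of_retract_map_mem J (p ^ e) he
  · obtain ⟨j, hjJ, hjP⟩ := SetLike.not_le_iff_exists.mp hJP
    have htop : J.map (algebraMap B (Localization.AtPrime P)) = ⊤ :=
      Ideal.eq_top_of_isUnit_mem _ (Ideal.mem_map_of_mem _ hjJ)
        (IsLocalization.map_units (Localization.AtPrime P) (⟨j, hjP⟩ : P.primeCompl))
    rw [htop]
    exact Submodule.mem_top

/-- **LEMMA L′ (clause form).** Along a split ring map `C → A'` (`ρ ∘ algebraMap = id`, `C` local): (H1′) weak regularity of the images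
of the systems of parameters of `C` on every localisation of `A'` at a maximal ideal, and (H2) inline Frobenius-closedness of the extended
parameter ideals at the maximal ideals over `𝔪_C`, imply the CM clause and the F-clause of the crux for `C` (expanded texts of
`SliceableCentre.CMCl C ∧ SliceableCentre.FCl p C`). [OURS; folklore assembly — statement res-L1-w45a-tri-2, proof res-L1-w45a-strat-1] -/
theorem cmcl_and_fcl_of_split (p : ℕ) (C A' : Type) [CommRing C] [CommRing A'] [IsLocalRing C]
    [Algebra C A'] (ρ : A' →ₗ[C] C) (hρ : ∀ c : C, ρ (algebraMap C A' c) = c)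
    (hCM : ∀ (N : Ideal A') [N.IsMaximal] (L : Type) [CommRing L] [Algebra A' L] [IsLocalization.AtPrime L N],
      ∀ d : ℕ, ringKrullDim C = d → ∀ s : Fin d → C, (Ideal.span (Set.range s)).radical.IsMaximal →
        RingTheory.Sequence.IsWeaklyRegular L (List.ofFn (fun i => algebraMap A' L (algebraMap C A' (s i)))))
    (hF : ∀ (N : Ideal A') [N.IsMaximal], (maximalIdeal C).map (algebraMap C A') ≤ N →
      ∀ (L : Type) [CommRing L] [Algebra A' L] [IsLocalization.AtPrime L N],
      ∀ d : ℕ, ringKrullDim C = d → ∀ s : Fin d → C, (Ideal.span (Set.range s)).radical.IsMaximal →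
        ∀ z : L, (∃ e : ℕ, z ^ p ^ e ∈ Ideal.span ((fun w : L => w ^ p ^ e) ''
            (((Ideal.span (Set.range s)).map (algebraMap C A')).map (algebraMap A' L) : Set L))) →
          z ∈ ((Ideal.span (Set.range s)).map (algebraMap C A')).map (algebraMap A' L)) :
    (∀ d : ℕ, ringKrullDim C = d → ∀ s : Fin d → C, (Ideal.span (Set.range s)).radical.IsMaximal →
        RingTheory.Sequence.IsWeaklyRegular C (List.ofFn s)) ∧
      ∀ d : ℕ, ringKrullDim C = d → ∀ s : Fin d → C, (Ideal.span (Set.range s)).radical.IsMaximal →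
        ∀ y : C, (∃ e : ℕ, y ^ p ^ e ∈ Ideal.span ((fun z : C => z ^ p ^ e) '' (Ideal.span (Set.range s) : Set C))) →
          y ∈ Ideal.span (Set.range s) := by
  have hρ1 : ρ 1 = 1 := by simpa only [map_one] using hρ 1
  refine ⟨?_, ?_⟩
  · intro d hd s hs
    refine isWeaklyRegular_of_retract_of_localization ρ hρ1 (List.ofFn s) fun P hP => ?_
    haveI := hP
    have h := hCM P (Localization.AtPrime P) d hd s hs
    rw [List.map_ofFn, List.map_ofFn]
    exact h
  · intro d hd s hs y hy
    set I : Ideal C := Ideal.span (Set.range s) with hI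
    have hmem : algebraMap C A' y ∈ I.map (algebraMap C A') := by
      refine mem_of_frobenius_localization_maximal_le p (I.map (algebraMap C A')) ?_ ?_
      · intro P hP hle z hz
        haveI := hP
        have hmax : (maximalIdeal C).map (algebraMap C A') ≤ P := by
          rw [Ideal.map_le_iff_le_comap]
          have h1 : I ≤ P.comap (algebraMap C A') := by
            rw [← Ideal.map_le_iff_le_comap]; exact hle
          have h2 : I.radical ≤ P.comap (algebraMap C A') :=
            (Ideal.IsPrime.radical_le_iff (Ideal.comap_isPrime _ _)).mpr h1
          rwa [IsLocalRing.eq_maximalIdeal hs] at h2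
        exact hF P hmax (Localization.AtPrime P) d hd s hs z hz
      · obtain ⟨e, he⟩ := hy
        refine ⟨e, ?_⟩
        rw [← map_pow]
        exact weaklyFRegularClause_of_retract_map_mem I (p ^ e) he
    rw [← hρ y]
    exact retract_mem ρ I hmem

/-- The same with the `IsNoetherianRing C` binder of the `H4LocRepairSig` §10⁵ signature `stub_lemmaLPrime` (unused by the proof;
kept so that the Sig's statement is closed by `exact`). [OURS] -/
theorem stub_lemmaLPrime_expanded (p : ℕ) (C A' : Type) [CommRing C] [CommRing A'] [IsNoetherianRing C] [IsLocalRing C]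
    [Algebra C A'] (ρ : A' →ₗ[C] C) (hρ : ∀ c : C, ρ (algebraMap C A' c) = c)
    (hCM : ∀ (N : Ideal A') [N.IsMaximal] (L : Type) [CommRing L] [Algebra A' L] [IsLocalization.AtPrime L N],
      ∀ d : ℕ, ringKrullDim C = d → ∀ s : Fin d → C, (Ideal.span (Set.range s)).radical.IsMaximal →
        RingTheory.Sequence.IsWeaklyRegular L (List.ofFn (fun i => algebraMap A' L (algebraMap C A' (s i)))))
    (hF : ∀ (N : Ideal A') [N.IsMaximal], (maximalIdeal C).map (algebraMap C A') ≤ N →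
      ∀ (L : Type) [CommRing L] [Algebra A' L] [IsLocalization.AtPrime L N],
      ∀ d : ℕ, ringKrullDim C = d → ∀ s : Fin d → C, (Ideal.span (Set.range s)).radical.IsMaximal →
        ∀ z : L, (∃ e : ℕ, z ^ p ^ e ∈ Ideal.span ((fun w : L => w ^ p ^ e) ''
            (((Ideal.span (Set.range s)).map (algebraMap C A')).map (algebraMap A' L) : Set L))) →
          z ∈ ((Ideal.span (Set.range s)).map (algebraMap C A')).map (algebraMap A' L)) :
    (∀ d : ℕ, ringKrullDim C = d → ∀ s : Fin d → C, (Ideal.span (Set.range s)).radical.IsMaximal →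
        RingTheory.Sequence.IsWeaklyRegular C (List.ofFn s)) ∧
      ∀ d : ℕ, ringKrullDim C = d → ∀ s : Fin d → C, (Ideal.span (Set.range s)).radical.IsMaximal →
        ∀ y : C, (∃ e : ℕ, y ^ p ^ e ∈ Ideal.span ((fun z : C => z ^ p ^ e) '' (Ideal.span (Set.range s) : Set C))) →
          y ∈ Ideal.span (Set.range s) :=
  cmcl_and_fcl_of_split p C A' ρ hρ hCM hF

end Summit.ResolutionOfSingularities.ResolutionOfSingularities.Theorems.FInjectiveMacaulayfication.LemmaLPrime
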